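import Summits.QuantumAdvantage.AdviceFreeQNC0.EndSupportedStrategies
import HarnessLib

/-!
# Cell qa-qnc0 (rung F-Q1, route RingFrame, crux α): walk characters of a strategy supported on the
# two ends and ONE interior window — local data plus two unknown block residues

Bookkeeping for the one-interior-window special case of the crux α (`RingHardU`, file
`OneWindowStrategies.lean`).  Fix a split point `Lb` (the window anchor) and a width `K`.  Write
`X = W_{Lb}(u) = |u_{<Lb}|` and `Z = |u| − X = |u_{≥Lb}|` for the weights of the two blocks.  The
walk character `c + g + |u| + |u_{<g}|` of position `g` is, modulo `3`,

* LEFT  (`g < K`):                 `(c + g + W_g(u)) + X + Z`,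
* MID   (`Lb ≤ g < Lb + K`):       `(c + g + #{Lb ≤ i < g : u_i}) + 2X + Z`,
* RIGHT (otherwise):               `(c + g + 2|u_{≥g}|) + 2X + 2Z`

(`windowChar_iff`), with LOCAL data depending on `< K` coordinates for the selected positions
of a strategy supported on `{g < K} ∪ [Lb, Lb+K) ∪ {g > n − K}`.  So the win bit is
`N(u; X, Z) mod 2`, `N(u; X', Z') = #{g selected : A_g(u) + α_g X' + β_g Z' ≢ 0 (3)}` with
`(α_g, β_g) ∈ {(1,1), (2,1), (2,2)}` (`ringWinU_eq_windowCount`); summed over the nine residue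
pairs `(X', Z')` the counts give `6·#selected` (`sum_windowCounts`), so some pair has an even
count (`exists_windowCount_even`) — the strategy loses whenever the true block residues hit it —
and each parity bit `[N(u; X', Z') odd]` has degree `≤ D + K` (`hasDeg_windowParity`).

The cell's statements (prover); not in print.  WHAT THIS IS NOT: the decoder and the appeal to
`jointElimHard` are in `OneWindowStrategies.lean`; nothing on ≥ 2 interior windows, on
`LDMAPolylog`, `TRPlus` or α in general; no separation.
-/

noncomputable section

namespace Summit.QuantumAdvantage.AdviceFreeQNC0

open Finset
open Literature.Computability.MetaComplexity Literature.Computability.MetaComplexity.Smolensky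

variable {n : ℕ}

/-! ### Prefix weights: monotonicity and the middle window -/

/-- `W_g(u) = W_{Lb}(u) + #{Lb ≤ i < g : u_i = 1}` for `Lb ≤ g`. [folklore] -/
theorem wtPrefix_eq_add_midCount (u : Fin n → Bool) {Lb g : ℕ} (h : Lb ≤ g) :
    wtPrefix u g = wtPrefix u Lb +
      (univ.filter fun i : Fin n => Lb ≤ i.val ∧ i.val < g ∧ u i = true).card := by
  unfold wtPrefix
  rw [← Finset.card_union_of_disjoint]
  · congr 1
    ext i
    simp only [Finset.mem_union, Finset.mem_filter, Finset.mem_univ, true_and]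
    constructor
    · rintro ⟨hi, hu⟩
      by_cases hl : i.val < Lb
      · exact Or.inl ⟨hl, hu⟩
      · exact Or.inr ⟨by omega, hi, hu⟩
    · rintro (⟨hi, hu⟩ | ⟨-, hi, hu⟩)
      · exact ⟨by omega, hu⟩
      · exact ⟨hi, hu⟩
  · exact Finset.disjoint_filter.2 fun i _ h1 h2 => by omega

/-- The middle count `#{Lb ≤ i < g : u_i}`, `g ≤ n`, is the weight of the window `u|_{[Lb, g)}`.
[folklore] -/
theorem midCount_eq_card_window (u : Fin n → Bool) {Lb g : ℕ} (hg : g ≤ n) :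
    (univ.filter fun i : Fin n => Lb ≤ i.val ∧ i.val < g ∧ u i = true).card =
      (univ.filter fun j : Fin (g - Lb) => u ⟨Lb + j.val, by omega⟩ = true).card := by
  rw [← Finset.card_image_of_injective
    (univ.filter fun j : Fin (g - Lb) => u ⟨Lb + j.val, by omega⟩ = true)
    (f := fun j : Fin (g - Lb) => (⟨Lb + j.val, by omega⟩ : Fin n))
    (fun j j' h => by have := Fin.mk.inj_iff.1 h; exact Fin.ext (by omega))]
  congr 1
  ext i
  simp only [Finset.mem_filter, Finset.mem_univ, true_and, Finset.mem_image]
  constructor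
  · rintro ⟨h1, h2, hui⟩
    refine ⟨⟨i.val - Lb, by omega⟩, ?_, Fin.ext (by simp; omega)⟩
    have e : (⟨Lb + (i.val - Lb), by omega⟩ : Fin n) = i := Fin.ext (by simp; omega)
    rw [e]; exact hui
  · rintro ⟨j, hj, rfl⟩
    exact ⟨by simp, by simp; omega, hj⟩

/-! ### The local form of the characters with two unknown block residues -/

/-- **Window form of the character at position `g`** (split point `Lb`, width `K`): modulo `3`
the character `c + g + |u| + W_g(u)` equals `A_g(u) + α_g·X + β_g·Z` with `X = W_{Lb}(u)`,
`Z = |u| − X`, and `(A_g, α_g, β_g)` = LEFT `(c + g + W_g, 1, 1)` for `g < K`, MID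
`(c + g + #{Lb ≤ i < g : u_i}, 2, 1)` for `Lb ≤ g < Lb + K`, RIGHT `(c + g + 2|u_{≥g}|, 2, 2)`
otherwise. (Cell bookkeeping.) -/
theorem windowChar_iff (c K Lb : ℕ) (u : Fin n → Bool) (g : Fin (n + 1)) (X' Z' : ℕ)
    (hX : X' = wtPrefix u Lb) (hZ : Z' = wt u - wtPrefix u Lb) :
    (c + g.val + walkExp u g.val) % 3 ≠ 0 ↔
      ((if g.val < K then c + g.val + wtPrefix u g.val
        else if Lb ≤ g.val ∧ g.val < Lb + K then
          c + g.val + (univ.filter fun i : Fin n => Lb ≤ i.val ∧ i.val < g.val ∧ u i = true).card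
        else c + g.val + 2 * (univ.filter fun i : Fin n => g.val ≤ i.val ∧ u i = true).card) +
        (if g.val < K then 1 else 2) * X' +
        (if g.val < K then 1 else if Lb ≤ g.val ∧ g.val < Lb + K then 1 else 2) * Z') % 3 ≠ 0 := by
  unfold walkExp
  have hsumL := wtPrefix_add_wtSuffix u Lb
  have hsumg := wtPrefix_add_wtSuffix u g.val
  have hXle : wtPrefix u Lb ≤ wt u := by omega
  subst hX; subst hZ
  by_cases hK : g.val < K
  · simp only [if_pos hK]
    constructor <;> intro h <;> omega
  · simp only [if_neg hK]
    by_cases hM : Lb ≤ g.val ∧ g.val < Lb + K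
    · simp only [if_pos hM]
      have hmid := wtPrefix_eq_add_midCount u hM.1
      constructor <;> intro h <;> omega
    · simp only [if_neg hM]
      constructor <;> intro h <;> omega

/-- The hypothetical count `N(u; X', Z')` depends on `X', Z'` only modulo `3`.
(Cell bookkeeping.) -/
theorem windowCount_mod (c K Lb : ℕ) (y : Fin (n + 1) → (Fin n → Bool) → Bool)
    (u : Fin n → Bool) (X' Z' : ℕ) :
    (univ.filter fun g : Fin (n + 1) => y g u = true ∧
      ((if g.val < K then c + g.val + wtPrefix u g.val
        else if Lb ≤ g.val ∧ g.val < Lb + K then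
          c + g.val + (univ.filter fun i : Fin n => Lb ≤ i.val ∧ i.val < g.val ∧ u i = true).card
        else c + g.val + 2 * (univ.filter fun i : Fin n => g.val ≤ i.val ∧ u i = true).card) +
        (if g.val < K then 1 else 2) * X' +
        (if g.val < K then 1 else if Lb ≤ g.val ∧ g.val < Lb + K then 1 else 2) * Z') % 3 ≠ 0).card =
    (univ.filter fun g : Fin (n + 1) => y g u = true ∧
      ((if g.val < K then c + g.val + wtPrefix u g.val
        else if Lb ≤ g.val ∧ g.val < Lb + K then
          c + g.val + (univ.filter fun i : Fin n => Lb ≤ i.val ∧ i.val < g.val ∧ u i = true).card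
        else c + g.val + 2 * (univ.filter fun i : Fin n => g.val ≤ i.val ∧ u i = true).card) +
        (if g.val < K then 1 else 2) * (X' % 3) +
        (if g.val < K then 1 else if Lb ≤ g.val ∧ g.val < Lb + K then 1 else 2) * (Z' % 3)) % 3 ≠ 0).card := by
  refine congrArg _ (Finset.filter_congr fun g _ => ?_)
  by_cases hK : g.val < K
  · simp only [if_pos hK]; constructor <;> rintro ⟨h1, h2⟩ <;> exact ⟨h1, by omega⟩
  · simp only [if_neg hK]
    by_cases hM : Lb ≤ g.val ∧ g.val < Lb + K
    · simp only [if_pos hM]; constructor <;> rintro ⟨h1, h2⟩ <;> exact ⟨h1, by omega⟩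
    · simp only [if_neg hM]; constructor <;> rintro ⟨h1, h2⟩ <;> exact ⟨h1, by omega⟩

/-- **The win bit is `N(u; X, Z) mod 2`** with the true block weights `X = W_{Lb}(u)`,
`Z = |u| − X` (any strategy, any split point and width). (Cell bookkeeping.) -/
theorem ringWinU_eq_windowCount (c K Lb : ℕ) (y : Fin (n + 1) → (Fin n → Bool) → Bool)
    (u : Fin n → Bool) :
    ringWinU c y u = decide ((univ.filter fun g : Fin (n + 1) => y g u = true ∧
      ((if g.val < K then c + g.val + wtPrefix u g.val
        else if Lb ≤ g.val ∧ g.val < Lb + K then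
          c + g.val + (univ.filter fun i : Fin n => Lb ≤ i.val ∧ i.val < g.val ∧ u i = true).card
        else c + g.val + 2 * (univ.filter fun i : Fin n => g.val ≤ i.val ∧ u i = true).card) +
        (if g.val < K then 1 else 2) * wtPrefix u Lb +
        (if g.val < K then 1 else if Lb ≤ g.val ∧ g.val < Lb + K then 1 else 2) *
          (wt u - wtPrefix u Lb)) % 3 ≠ 0).card % 2 = 1) := by
  have h : (univ.filter fun g : Fin (n + 1) =>
      y g u = true ∧ (c + g.val + walkExp u g.val) % 3 ≠ 0) =
      univ.filter fun g : Fin (n + 1) => y g u = true ∧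
      ((if g.val < K then c + g.val + wtPrefix u g.val
        else if Lb ≤ g.val ∧ g.val < Lb + K then
          c + g.val + (univ.filter fun i : Fin n => Lb ≤ i.val ∧ i.val < g.val ∧ u i = true).card
        else c + g.val + 2 * (univ.filter fun i : Fin n => g.val ≤ i.val ∧ u i = true).card) +
        (if g.val < K then 1 else 2) * wtPrefix u Lb +
        (if g.val < K then 1 else if Lb ≤ g.val ∧ g.val < Lb + K then 1 else 2) *
          (wt u - wtPrefix u Lb)) % 3 ≠ 0 := by
    refine Finset.filter_congr fun g _ => ?_
    rw [windowChar_iff c K Lb u g (wtPrefix u Lb) (wt u - wtPrefix u Lb) rfl rfl]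
  unfold ringWinU
  rw [h]

/-! ### The parity obstruction over the nine residue pairs -/

/-- **Parity obstruction, two unknowns.**  For selected positions with local data `A_g` and
multipliers `α_g`, `β_g ∈ {1,2}`, the nine counts `N(X', Z') = #{g : A_g + α_g X' + β_g Z' ≢ 0}`
sum to six times the number of selected positions. (Cell statement.) -/
theorem sum_windowCounts {ι : Type*} (s : Finset ι) (A α β : ι → ℕ)
    (hβ : ∀ g ∈ s, β g % 3 ≠ 0) :
    (∑ X' ∈ range 3, ∑ Z' ∈ range 3,
      (s.filter fun g => (A g + α g * X' + β g * Z') % 3 ≠ 0).card) = 6 * s.card := by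
  classical
  have hin : ∀ X' ∈ range 3, (∑ Z' ∈ range 3,
      (s.filter fun g => (A g + α g * X' + β g * Z') % 3 ≠ 0).card) = 2 * s.card := by
    intro X' _
    exact sum_endCounts_even s (fun g => A g + α g * X') β hβ
  rw [Finset.sum_congr rfl hin, Finset.sum_const, Finset.card_range, smul_eq_mul]
  ring

/-- Hence some residue pair `(X₀, Z₀)`, `X₀, Z₀ < 3`, has an even count. [folklore] -/
theorem exists_windowCount_even {ι : Type*} (s : Finset ι) (A α β : ι → ℕ)
    (hβ : ∀ g ∈ s, β g % 3 ≠ 0) :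
    ∃ X₀ Z₀, X₀ < 3 ∧ Z₀ < 3 ∧
      (s.filter fun g => (A g + α g * X₀ + β g * Z₀) % 3 ≠ 0).card % 2 = 0 := by
  by_contra hno
  push Not at hno
  have hs := sum_windowCounts s A α β hβ
  have hodd : ∀ X' ∈ range 3, ∀ Z' ∈ range 3,
      (s.filter fun g => (A g + α g * X' + β g * Z') % 3 ≠ 0).card % 2 = 1 := by
    intro X' hX Z' hZ
    have := hno X' Z' (Finset.mem_range.1 hX) (Finset.mem_range.1 hZ)
    omega
  -- the sum of nine odd numbers is odd
  have h9 : (∑ X' ∈ range 3, ∑ Z' ∈ range 3,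
      (s.filter fun g => (A g + α g * X' + β g * Z') % 3 ≠ 0).card) % 2 = 1 := by
    rw [Finset.sum_nat_mod]
    have hin : ∀ X' ∈ range 3, (∑ Z' ∈ range 3,
        (s.filter fun g => (A g + α g * X' + β g * Z') % 3 ≠ 0).card) % 2 = 1 := by
      intro X' hX
      rw [Finset.sum_nat_mod, Finset.sum_congr rfl (fun Z' hZ => hodd X' hX Z' hZ)]
      simp
    rw [Finset.sum_congr rfl hin]
    simp
  rw [hs] at h9
  omega

/-! ### Degree of the parity bits -/

/-- **Each parity bit `[N(u; X', Z') odd]` has degree `≤ D + K`** for a strategy of degree `≤ D`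
supported on `{g < K} ∪ [Lb, Lb + K) ∪ {g > n − K}`: every term is a selector times a function
of `< K` coordinates, or zero. (Cell statement.) -/
theorem hasDeg_windowParity {D : ℕ} (c K Lb : ℕ) (y : Fin (n + 1) → (Fin n → Bool) → Bool)
    (hdeg : ∀ g, HasDeg (y g) D)
    (hsupp : ∀ g : Fin (n + 1), K ≤ g.val → (g.val < Lb ∨ Lb + K ≤ g.val) → g.val + K ≤ n →
      ∀ u, y g u = false)
    (X' Z' : ℕ) :
    HasDeg (fun u : Fin n → Bool => decide ((univ.filter fun g : Fin (n + 1) =>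
      (y g u && decide (((if g.val < K then c + g.val + wtPrefix u g.val
        else if Lb ≤ g.val ∧ g.val < Lb + K then
          c + g.val + (univ.filter fun i : Fin n => Lb ≤ i.val ∧ i.val < g.val ∧ u i = true).card
        else c + g.val + 2 * (univ.filter fun i : Fin n => g.val ≤ i.val ∧ u i = true).card) +
        (if g.val < K then 1 else 2) * X' +
        (if g.val < K then 1 else if Lb ≤ g.val ∧ g.val < Lb + K then 1 else 2) * Z') % 3 ≠ 0))
          = true).card % 2 = 1)) (D + K) := by
  classical
  refine hasDeg_parity _ _ fun g _ => ?_
  by_cases hgK : g.val < K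
  · -- LEFT: window `[0, g)`
    have hgn : g.val ≤ n := by omega
    have h := hasDeg_comp_window (n := n) (Fin.castLE hgn)
      (fun v : Fin g.val → Bool => decide ((c + g.val +
        (univ.filter fun j : Fin g.val => v j = true).card + 1 * X' + 1 * Z') % 3 ≠ 0))
    have heq : (fun u : Fin n → Bool => decide (((if g.val < K then c + g.val + wtPrefix u g.val
        else if Lb ≤ g.val ∧ g.val < Lb + K then
          c + g.val + (univ.filter fun i : Fin n => Lb ≤ i.val ∧ i.val < g.val ∧ u i = true).card
        else c + g.val + 2 * (univ.filter fun i : Fin n => g.val ≤ i.val ∧ u i = true).card) +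
        (if g.val < K then 1 else 2) * X' +
        (if g.val < K then 1 else if Lb ≤ g.val ∧ g.val < Lb + K then 1 else 2) * Z') % 3 ≠ 0)) =
        fun u : Fin n → Bool => (fun v : Fin g.val → Bool => decide ((c + g.val +
          (univ.filter fun j : Fin g.val => v j = true).card + 1 * X' + 1 * Z') % 3 ≠ 0))
          (fun j => u (Fin.castLE hgn j)) := by
      funext u
      simp only [if_pos hgK, wtPrefix_eq_card_window u hgn]
    rw [← heq] at h
    exact hasDeg_and (hdeg g) (hasDeg_of_le h (by omega))
  · by_cases hgM : Lb ≤ g.val ∧ g.val < Lb + K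
    · -- MID: window `[Lb, g)`
      have hgn : g.val ≤ n := by omega
      have h := hasDeg_comp_window (n := n)
        (fun j : Fin (g.val - Lb) => (⟨Lb + j.val, by omega⟩ : Fin n))
        (fun v : Fin (g.val - Lb) → Bool => decide ((c + g.val +
          (univ.filter fun j : Fin (g.val - Lb) => v j = true).card + 2 * X' + 1 * Z') % 3 ≠ 0))
      have heq : (fun u : Fin n → Bool => decide (((if g.val < K then c + g.val + wtPrefix u g.val
          else if Lb ≤ g.val ∧ g.val < Lb + K then
            c + g.val + (univ.filter fun i : Fin n => Lb ≤ i.val ∧ i.val < g.val ∧ u i = true).card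
          else c + g.val + 2 * (univ.filter fun i : Fin n => g.val ≤ i.val ∧ u i = true).card) +
          (if g.val < K then 1 else 2) * X' +
          (if g.val < K then 1 else if Lb ≤ g.val ∧ g.val < Lb + K then 1 else 2) * Z') % 3 ≠ 0)) =
          fun u : Fin n → Bool => (fun v : Fin (g.val - Lb) → Bool => decide ((c + g.val +
            (univ.filter fun j : Fin (g.val - Lb) => v j = true).card + 2 * X' + 1 * Z') % 3 ≠ 0))
            (fun j => u ⟨Lb + j.val, by omega⟩) := by
        funext u
        simp only [if_neg hgK, if_pos hgM, midCount_eq_card_window u hgn]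
      rw [← heq] at h
      exact hasDeg_and (hdeg g) (hasDeg_of_le h (by omega))
    · by_cases hgR : n < g.val + K
      · -- RIGHT: window `[g, n)`
        have hgn : g.val ≤ n := by omega
        have h := hasDeg_comp_window (n := n)
          (fun j : Fin (n - g.val) => (⟨g.val + j.val, by omega⟩ : Fin n))
          (fun v : Fin (n - g.val) → Bool => decide ((c + g.val +
            2 * (univ.filter fun j : Fin (n - g.val) => v j = true).card + 2 * X' + 2 * Z') % 3 ≠ 0))
        have heq : (fun u : Fin n → Bool => decide (((if g.val < K then c + g.val + wtPrefix u g.val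
            else if Lb ≤ g.val ∧ g.val < Lb + K then
              c + g.val + (univ.filter fun i : Fin n => Lb ≤ i.val ∧ i.val < g.val ∧ u i = true).card
            else c + g.val + 2 * (univ.filter fun i : Fin n => g.val ≤ i.val ∧ u i = true).card) +
            (if g.val < K then 1 else 2) * X' +
            (if g.val < K then 1 else if Lb ≤ g.val ∧ g.val < Lb + K then 1 else 2) * Z') % 3 ≠ 0)) =
            fun u : Fin n → Bool => (fun v : Fin (n - g.val) → Bool => decide ((c + g.val +
              2 * (univ.filter fun j : Fin (n - g.val) => v j = true).card + 2 * X' + 2 * Z') % 3 ≠ 0))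
              (fun j => u ⟨g.val + j.val, by omega⟩) := by
          funext u
          simp only [if_neg hgK, if_neg hgM, wtSuffix_eq_card_window u hgn]
        rw [← heq] at h
        exact hasDeg_and (hdeg g) (hasDeg_of_le h (by omega))
      · -- interior: the selector vanishes
        push Not at hgK hgR
        have hout : g.val < Lb ∨ Lb + K ≤ g.val := by
          by_contra hno; push Not at hno; exact hgM ⟨hno.1, hno.2⟩
        have hzero : (fun u : Fin n → Bool => y g u && decide (((if g.val < K then
            c + g.val + wtPrefix u g.val
            else if Lb ≤ g.val ∧ g.val < Lb + K then
              c + g.val + (univ.filter fun i : Fin n => Lb ≤ i.val ∧ i.val < g.val ∧ u i = true).card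
            else c + g.val + 2 * (univ.filter fun i : Fin n => g.val ≤ i.val ∧ u i = true).card) +
            (if g.val < K then 1 else 2) * X' +
            (if g.val < K then 1 else if Lb ≤ g.val ∧ g.val < Lb + K then 1 else 2) * Z') % 3 ≠ 0)) =
            fun _ => false := by
          funext u; rw [hsupp g hgK hout hgR u, Bool.false_and]
        rw [hzero]
        exact hasDeg_false _

end Summit.QuantumAdvantage.AdviceFreeQNC0
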